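import Summits.HodgeConjecture.HodgeConjecture.Theorems.R90S2ArchProductFamilyOfQuotient   -- ★ FILE 3c (mine): `isArchProductFamily_archLocWeilFamily` (+ ★ 3b `archLocWeilFamily`, `archLocTorusMeasure`, ★ 3a)
import Summits.HodgeConjecture.HodgeConjecture.Theorems.R90S2ArchStableOrbitalProduct      -- ★ CARD 3: `isArchStablyNull_of_place`, `archLocalStableOrbitalIntegral` (+ ★ S10 `IsArchStablyNull`, `GInf`, `phi3`)
import Summits.HodgeConjecture.HodgeConjecture.Theorems.R90S2ArchPureTensor                -- ★ CARD 2: `archTensor`, `archTensor_apply`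
import Literature.NumberTheory.Automorphic.LocalUnitaryGroupCongr                          -- ★ `isUnit_antidiagOne_det`
import HarnessLib

/-!
# R90-TF ∕ S2 «Ch. 12 archimedean block» — `R90S2ArchStablyNullOfLocal` (CARD 11): clause (E2) of the endoscopy letter FROM LOCAL STABLE NULLITY at ONE place
# (print p. 218 L18–21 is a LOCAL statement: `f_u = f_{1u} − f_{2u}` has vanishing stable orbital integrals on `U(σ_u Φ₃)(ℂ)`)

Cell `pub/hodgecm-mathlib`, HCML Track R90-TF, section S2 (base `R90-C11`), crux h413 = `stmt-HodgeConjecture-24833`, route of record `HCCMUnconditional`; prover seat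
LH4-p05 (g11) (S2 desk K2E1b-plan (g8) deal 2026-09-05T03:22:19Z «CARD 11»); lane `--kind definition --supports stmt-HodgeConjecture-24833 --as helper` (ONE `def`, a
`Prop`).  Conventions of ★ FILE 1: no socket, no instance, no notation, no `sorry`, default heartbeats.

## WHAT
Today clause (E2) of ★ `ArchBlockPacketEndoscopyLetter` is GLOBAL («the one-place difference tensor is ★ `S10.IsArchStablyNull L mG`»).  Print's statement is LOCAL at
the place `u`.  With ★ CARD 3 `isArchStablyNull_of_place` (per-stable-class product family + local stable vanishing at `u` ⇒ global) and ★ FILE 3c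
`isArchProductFamily_archLocWeilFamily` (T2's (W)(C) + `ν ≅ ⊗ νw` ⇒ such a family, the LOCAL WEIL FAMILIES ★ `archLocWeilFamily` for the STABLY TRANSPORTED torus
measures ★ `archLocTorusMeasure`), the composition is:
* §1 `IsArchLocStablyNull L w νw ψ` — **LOCAL STABLE NULLITY of `ψ` on `U(σ_w Φ₃)(ℂ)` for the local Haar measure `νw`**: for every regular base point `δ₀`, every
  Haar measure `τ₀` on its torus `Z(δ₀)` and every local orbital-measure family `mLoc` in WEIL FORM for `νw` and the stably transported torus measures
  `archLocTorusMeasure Φ₃ hΦ h₀ τ₀` on the stable class of `δ₀` (★ `OrbitalMeasureFamily.IsQuotientOf`), the local stable orbital integral vanishes: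
  `archLocalStableOrbitalIntegral L Φ₃ w mLoc ψ δ₀ = 0`.  DESIGN: the torus measures are quantified through the BASE measure `τ₀` and the ★ transport family (stable
  coherence built in — print's «compatible measures» [§1.7, §4.3]; a hypothesis of mere conjugation coherence would let the conjugacy classes inside one stable class
  be rescaled independently and make Shelstad's vanishing false as a letter); no admissibility ∕ junk clause is a hypothesis (the stable integral reads `mLoc` only on
  the class, where the Weil form pins it).  `isArchLocStablyNull_iff` unfolds it (the topological instances of `U(σ_w Φ₃)(ℂ)` inside the def are ★
  `locallyCompactSpace_archLocal` ∕ ★ `secondCountableTopology_archLocal`; on the `_iff` they are binders).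
* §2 `isArchStablyNull_archTensor_of_isArchLocStablyNull` — **(E2) FROM ONE PLACE**: in T2's frame ((W) `mG.IsQuotientOf (IsRegularElt ·) ν t`, (C) VERBATIM,
  `ν.map e = ⊗ νw`), a pure tensor `⊗_w φ_w` whose factor at `u` is locally stably null IS ★ `S10.IsArchStablyNull L mG` — ★ CARD 3 at `hf := archTensor_apply` with
  `hu γ hγ := ⟨archLocWeilFamily …, ★ 3c product clause, hloc at γ_u⟩` (`τ⁰` from ★ 3b `exists_pi_eq_map_archCentralizerPiEquiv`, `t γ` Haar by ★
  `atPoint_eq_quotientMeasure_of_isQuotientOf_of_archCoherent`).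
* §3 `isArchStablyNull_archTensor_update_of_isArchLocStablyNull` — the same for `⊗ (update φ u ψ)` with `ψ` locally stably null at `u` (the shape of the frozen
  one-place difference `(f_{1u} − f_{2u}) ⊗ ⊗_{w ≠ u} f_w`, ★ CARD 2 `archTensor_update_sub`).
LATER USE (not here): ℓT2-E splits into the global (E1)(E3) and a LOCAL letter ℓ4 «`IsArchLocStablyNull L u (νw u) ⇑((d u).φ (d u).bpos − (d u).φ (d u).bneg)`»
(Shelstad's spectral characterisation) discharging (E2) through §2∕§3.

HONEST LABEL: composition plumbing that RELOCATES a letter clause from global to print's LOCAL shape; pays nothing printed (the local vanishing itself stays letter ℓ4);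
HC_CM is proved only modulo the 7 printed citations (2 remaining named inputs: hLiu418 = `stmt-HodgeConjecture-24832`, h413 = `stmt-HodgeConjecture-24833`) until rung 0
closes.  Count-neutral.

References: [Rogawski1990] §13.8 Prop. 13.8.3 (proof) p. 218 L18–21, §4.1 (4.1.1) p. 39, §4.3 (4.3.1) p. 43, §1.7 p. 6; [Shelstad1979] L. 5.3, §4 p. 20;
[Arthur1988InvariantTraceFormulaII] §7.
-/

set_option autoImplicit false
set_option linter.dupNamespace false  -- the route namespace `Summit.HodgeConjecture.HodgeConjecture.…` repeats a component by design (as ★ FILE 1)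

noncomputable section

open MeasureTheory NumberField NumberField.InfinitePlace CompactlySupported
open scoped Matrix MatrixGroups Classical
open Literature.NumberTheory.Automorphic Literature.NumberTheory.Automorphic.UnitaryGroup
open Literature.NumberTheory.Rogawski1990
open Literature.MeasureTheory.Group

namespace Summit.HodgeConjecture.HodgeConjecture.R90.S2

/-! ## §1 Local stable nullity at one complex place -/

section Local

variable (L : Type) [Field L] (w : {w : InfinitePlace L // w.IsComplex})
  [MeasurableSpace ↥(archLocal L 3 (S10.phi3 L) w)] [BorelSpace ↥(archLocal L 3 (S10.phi3 L) w)]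
  [∀ δ : ↥(archLocal L 3 (S10.phi3 L) w), MeasurableSpace (↥(archLocal L 3 (S10.phi3 L) w) ⧸ Subgroup.centralizer ({δ} : Set ↥(archLocal L 3 (S10.phi3 L) w)))]
  [∀ δ : ↥(archLocal L 3 (S10.phi3 L) w), BorelSpace (↥(archLocal L 3 (S10.phi3 L) w) ⧸ Subgroup.centralizer ({δ} : Set ↥(archLocal L 3 (S10.phi3 L) w)))]

/-- **LOCAL STABLE NULLITY of `ψ` on `U(σ_w Φ₃)(ℂ)` for the local Haar measure `νw`** (print p. 218 L18–21 read at the place `u`: «`f_u = f_{1u} − f_{2u}` has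
vanishing stable orbital integrals»): for every REGULAR base point `δ₀`, every Haar measure `τ₀` on the torus `Z(δ₀)` and every local orbital-measure family
`mLoc` in WEIL FORM (Deitmar–Echterhoff quotients `dνw ∕ dτ`) for `νw` and the STABLY TRANSPORTED torus measures `archLocTorusMeasure Φ₃ _ h₀ τ₀` on the stable
class of `δ₀` (print's «compatible measures», transported along the canonical torus isomorphisms), the local stable orbital integral of `ψ` at `δ₀` vanishes
(`archLocalStableOrbitalIntegral`, (4.1.1) with `κ` trivial).  The topological instances of the factor are supplied inside (`isArchLocStablyNull_iff` unfolds).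
(Prose locators: Rogawski 1990 §13.8 p. 218, §4.1 (4.1.1), §4.3 (4.3.1), §1.7; Shelstad 1979 §4 p. 20 — tags on the `_iff`.) -/
def IsArchLocStablyNull (νw : Measure ↥(archLocal L 3 (S10.phi3 L) w)) [IsFiniteMeasureOnCompacts νw] [νw.IsMulRightInvariant]
    (ψ : ↥(archLocal L 3 (S10.phi3 L) w) → ℂ) : Prop := by
  haveI := locallyCompactSpace_archLocal L 3 (S10.phi3 L) w
  haveI := secondCountableTopology_archLocal L 3 (S10.phi3 L) w
  exact ∀ (δ₀ : ↥(archLocal L 3 (S10.phi3 L) w)) (h₀ : IsRegularElt (δ₀ : GL (Fin 3) ℂ))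
    (τ₀ : Measure (Subgroup.centralizer ({δ₀} : Set ↥(archLocal L 3 (S10.phi3 L) w)))) [τ₀.IsHaarMeasure]
    (mLoc : OrbitalMeasureFamily ↥(archLocal L 3 (S10.phi3 L) w)),
    mLoc.IsQuotientOf (fun δ : ↥(archLocal L 3 (S10.phi3 L) w) => IsStablyConj (starRingEnd ℂ) ((S10.phi3 L).map w.1.embedding) δ₀ δ) νw
        (archLocTorusMeasure (S10.phi3 L) (isUnit_antidiagOne_det L 3).ne_zero h₀ τ₀) →
      archLocalStableOrbitalIntegral L (S10.phi3 L) w mLoc ψ δ₀ = 0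

/-- Unfolding of `IsArchLocStablyNull` (definitional; the topological instance binders are ★ `locallyCompactSpace_archLocal` ∕ ★ `secondCountableTopology_archLocal`).
[cite: Rogawski1990, §13.8 p. 218 L18–21; §4.1 (4.1.1) p. 39; §4.3 (4.3.1) p. 43] [cite: Shelstad1979, §4 p. 20] -/
theorem isArchLocStablyNull_iff [LocallyCompactSpace ↥(archLocal L 3 (S10.phi3 L) w)] [SecondCountableTopology ↥(archLocal L 3 (S10.phi3 L) w)]
    (νw : Measure ↥(archLocal L 3 (S10.phi3 L) w)) [IsFiniteMeasureOnCompacts νw] [νw.IsMulRightInvariant] (ψ : ↥(archLocal L 3 (S10.phi3 L) w) → ℂ) :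
    IsArchLocStablyNull L w νw ψ ↔
      ∀ (δ₀ : ↥(archLocal L 3 (S10.phi3 L) w)) (h₀ : IsRegularElt (δ₀ : GL (Fin 3) ℂ))
        (τ₀ : Measure (Subgroup.centralizer ({δ₀} : Set ↥(archLocal L 3 (S10.phi3 L) w)))) [τ₀.IsHaarMeasure]
        (mLoc : OrbitalMeasureFamily ↥(archLocal L 3 (S10.phi3 L) w)),
        mLoc.IsQuotientOf (fun δ : ↥(archLocal L 3 (S10.phi3 L) w) => IsStablyConj (starRingEnd ℂ) ((S10.phi3 L).map w.1.embedding) δ₀ δ) νw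
            (archLocTorusMeasure (S10.phi3 L) (isUnit_antidiagOne_det L 3).ne_zero h₀ τ₀) →
          archLocalStableOrbitalIntegral L (S10.phi3 L) w mLoc ψ δ₀ = 0 :=
  Iff.rfl

/-- The zero function is locally stably null (the shape is not vacuous). [cite: Rogawski1990, §4.1 (4.1.1) p. 39] -/
theorem isArchLocStablyNull_zero (νw : Measure ↥(archLocal L 3 (S10.phi3 L) w)) [IsFiniteMeasureOnCompacts νw] [νw.IsMulRightInvariant] :
    IsArchLocStablyNull L w νw (0 : ↥(archLocal L 3 (S10.phi3 L) w) → ℂ) := by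
  intro δ₀ _ τ₀ _ mLoc _
  exact stableOrbitalIntegralRel_zero _ _ _

end Local

/-! ## §2 (E2) of the endoscopy letter from local stable nullity at ONE place, in T2's measure frame -/

section Global

variable (L : Type) [Field L] [NumberField L] [IsCMField L]
  [MeasurableSpace (S10.GInf L)] [BorelSpace (S10.GInf L)]
  [∀ γ : S10.GInf L, MeasurableSpace (S10.GInf L ⧸ Subgroup.centralizer ({γ} : Set (S10.GInf L)))]
  [∀ γ : S10.GInf L, BorelSpace (S10.GInf L ⧸ Subgroup.centralizer ({γ} : Set (S10.GInf L)))]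
  [∀ w : {w : InfinitePlace L // w.IsComplex}, MeasurableSpace ↥(archLocal L 3 (S10.phi3 L) w)]
  [∀ w : {w : InfinitePlace L // w.IsComplex}, BorelSpace ↥(archLocal L 3 (S10.phi3 L) w)]
  [∀ (w : {w : InfinitePlace L // w.IsComplex}) (δ : ↥(archLocal L 3 (S10.phi3 L) w)),
    MeasurableSpace (↥(archLocal L 3 (S10.phi3 L) w) ⧸ Subgroup.centralizer ({δ} : Set ↥(archLocal L 3 (S10.phi3 L) w)))]
  [∀ (w : {w : InfinitePlace L // w.IsComplex}) (δ : ↥(archLocal L 3 (S10.phi3 L) w)),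
    BorelSpace (↥(archLocal L 3 (S10.phi3 L) w) ⧸ Subgroup.centralizer ({δ} : Set ↥(archLocal L 3 (S10.phi3 L) w)))]

/-- **(E2) FROM LOCAL STABLE NULLITY AT ONE PLACE** (print p. 218 L18–21, Prop. 13.8.3's proof).  In T2's archimedean measure frame — `mG` the Weil quotient of the Haar
measure `ν` by torus measures `t` on the regular classes ((W), ★ `OrbitalMeasureFamily.IsQuotientOf`), `t` coherent under stable conjugacy ((C), ★
`archStableCentralizerEquiv`), `ν` factoring as `⊗ νw` along ★ `archPiEquivCM` (★ CARD 6 `exists_pi_eq_map_archPiEquivCM` for any Haar `ν`) — a pure tensor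
`⊗_w φ_w` whose factor at ONE place `u` is LOCALLY STABLY NULL has vanishing stable orbital integrals at every regular element of `G_∞`: ★ `S10.IsArchStablyNull L mG`.
Proof: ★ CARD 3 `isArchStablyNull_of_place` with, at each regular `γ`, the local Weil families of ★ FILE 3b tied to `mG` on the stable class of `γ` by ★ FILE 3c
`isArchProductFamily_archLocWeilFamily` and the local hypothesis read at `γ_u`. [cite: Rogawski1990, §13.8 p. 218 L18–21; §4.1 (4.1.1) p. 39; §4.3 (4.3.1) p. 43]
[cite: Shelstad1979, L. 5.3] [cite: Arthur1988InvariantTraceFormulaII, §7] -/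
theorem isArchStablyNull_archTensor_of_isArchLocStablyNull
    {ν : Measure (S10.GInf L)} [ν.IsHaarMeasure] [ν.IsMulRightInvariant]
    {t : ∀ γ : S10.GInf L, Measure (Subgroup.centralizer ({γ} : Set (S10.GInf L)))} {mG : OrbitalMeasureFamily (S10.GInf L)}
    (hW : mG.IsQuotientOf (fun γ : S10.GInf L => IsRegularElt (γ.val : GL (Fin 3) (mixedEmbedding.mixedSpace L))) ν t)
    (hC : ∀ (γ₁ γ₂ : S10.GInf L) (h₁ : IsRegularElt (γ₁.val : GL (Fin 3) (mixedEmbedding.mixedSpace L)))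
        (hc : Corresponds (conjMixed (↥(maximalRealSubfield L)) L (IsCMField.complexConj L)) (archFormOf L 3 (S10.phi3 L)) (archFormOf L 3 (S10.phi3 L)) γ₁ γ₂),
        Measure.map (archStableCentralizerEquiv L (isUnit_antidiagOne_det L 3).ne_zero (isUnit_antidiagOne_det L 3).ne_zero hc h₁) (t γ₁) = t γ₂)
    (νw : ∀ w : {w : InfinitePlace L // w.IsComplex}, Measure ↥(archLocal L 3 (S10.phi3 L) w)) [∀ w, (νw w).IsHaarMeasure] [∀ w, (νw w).IsMulRightInvariant]
    (hν : ν.map ⇑(archPiEquivCM L (S10.phi3 L) (N := 3)) = Measure.pi νw)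
    (φ : ∀ w : {w : InfinitePlace L // w.IsComplex}, C_c(↥(archLocal L 3 (S10.phi3 L) w), ℂ)) (u : {w : InfinitePlace L // w.IsComplex})
    (hloc : IsArchLocStablyNull L u (νw u) ⇑(φ u)) :
    S10.IsArchStablyNull L mG ⇑(archTensor L (S10.phi3 L) φ) := by
  haveI : ∀ w : {w : InfinitePlace L // w.IsComplex}, LocallyCompactSpace ↥(archLocal L 3 (S10.phi3 L) w) := fun w =>
    locallyCompactSpace_archLocal L 3 (S10.phi3 L) w
  haveI : ∀ w : {w : InfinitePlace L // w.IsComplex}, SecondCountableTopology ↥(archLocal L 3 (S10.phi3 L) w) := fun w =>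
    secondCountableTopology_archLocal L 3 (S10.phi3 L) w
  refine @isArchStablyNull_of_place L _ _ _ _ (fun w δ => inferInstance) mG _ (fun w => ⇑(φ w)) (fun g => archTensor_apply L (S10.phi3 L) φ g) u
    (fun γ hγ => ?_)
  -- (W)+(C) at the regular point `γ`: `t γ` is a Haar measure; decompose it along `Z(γ) ≅ ∏_w Z(γ_w)`
  obtain ⟨htγ, -, -⟩ := atPoint_eq_quotientMeasure_of_isQuotientOf_of_archCoherent L (isUnit_antidiagOne_det L 3).ne_zero hW hC γ hγ
  obtain ⟨τ₀, hτ₀H, hτ₀⟩ := exists_pi_eq_map_archCentralizerPiEquiv (S10.phi3 L) γ (t γ)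
  haveI : ∀ w, (τ₀ w).IsHaarMeasure := hτ₀H
  exact ⟨fun w => archLocWeilFamily (S10.phi3 L) (isUnit_antidiagOne_det L 3).ne_zero (isRegularElt_archPiEquivCM (S10.phi3 L) γ hγ w) (τ₀ w) (νw w),
    isArchProductFamily_archLocWeilFamily (S10.phi3 L) (isUnit_antidiagOne_det L 3).ne_zero hW hC νw hν γ hγ τ₀ hτ₀,
    hloc (archPiEquivCM L (S10.phi3 L) (N := 3) γ u) (isRegularElt_archPiEquivCM (S10.phi3 L) γ hγ u) (τ₀ u) _
      (archLocWeilFamily_isQuotientOf (S10.phi3 L) (isUnit_antidiagOne_det L 3).ne_zero _ (τ₀ u) (νw u))⟩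

/-- **(E2) for the one-place replacement tensor**: if `ψ` is locally stably null at `u`, the pure tensor `⊗ (update φ u ψ)` is ★ `S10.IsArchStablyNull L mG` — the shape of the
frozen difference `(f_{1u} − f_{2u}) ⊗ ⊗_{w ≠ u} f_w` (★ CARD 2 `archTensor_update_sub`). [cite: Rogawski1990, §13.8 p. 218 L18–21] [cite: Shelstad1979, L. 5.3] -/
theorem isArchStablyNull_archTensor_update_of_isArchLocStablyNull
    {ν : Measure (S10.GInf L)} [ν.IsHaarMeasure] [ν.IsMulRightInvariant]
    {t : ∀ γ : S10.GInf L, Measure (Subgroup.centralizer ({γ} : Set (S10.GInf L)))} {mG : OrbitalMeasureFamily (S10.GInf L)}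
    (hW : mG.IsQuotientOf (fun γ : S10.GInf L => IsRegularElt (γ.val : GL (Fin 3) (mixedEmbedding.mixedSpace L))) ν t)
    (hC : ∀ (γ₁ γ₂ : S10.GInf L) (h₁ : IsRegularElt (γ₁.val : GL (Fin 3) (mixedEmbedding.mixedSpace L)))
        (hc : Corresponds (conjMixed (↥(maximalRealSubfield L)) L (IsCMField.complexConj L)) (archFormOf L 3 (S10.phi3 L)) (archFormOf L 3 (S10.phi3 L)) γ₁ γ₂),
        Measure.map (archStableCentralizerEquiv L (isUnit_antidiagOne_det L 3).ne_zero (isUnit_antidiagOne_det L 3).ne_zero hc h₁) (t γ₁) = t γ₂)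
    (νw : ∀ w : {w : InfinitePlace L // w.IsComplex}, Measure ↥(archLocal L 3 (S10.phi3 L) w)) [∀ w, (νw w).IsHaarMeasure] [∀ w, (νw w).IsMulRightInvariant]
    (hν : ν.map ⇑(archPiEquivCM L (S10.phi3 L) (N := 3)) = Measure.pi νw)
    (φ : ∀ w : {w : InfinitePlace L // w.IsComplex}, C_c(↥(archLocal L 3 (S10.phi3 L) w), ℂ)) (u : {w : InfinitePlace L // w.IsComplex})
    (ψ : C_c(↥(archLocal L 3 (S10.phi3 L) u), ℂ)) (hloc : IsArchLocStablyNull L u (νw u) ⇑ψ) :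
    S10.IsArchStablyNull L mG ⇑(archTensor L (S10.phi3 L) (Function.update φ u ψ)) :=
  isArchStablyNull_archTensor_of_isArchLocStablyNull L hW hC νw hν (Function.update φ u ψ) u (by rwa [Function.update_self])

end Global

end Summit.HodgeConjecture.HodgeConjecture.R90.S2

end
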